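import Literature.Computability.QuantumComplexity.OpBitsAbstract
import Literature.Computability.QuantumComplexity.CleanXorDesc
import Literature.Computability.QuantumComplexity.CleanRevBlockDesc
import HarnessLib

/-!
# The abstract gate list of a clean XOR block, on codes

Topic `Computability/QuantumComplexity`: the assembly of `CleanXorAbstract.lean` (`CleanXor.map_toAG_circuit`:
the abstract gate list of `CleanXor.circuit G` is `progA (P ++ xorOpsN ++ reverse P)`, `P` the relabelled clean block),
`OpBitsAbstract.lean` (the clean word `progA (cleanOps e M N [])` on codes, the bridge `codeFP_progA_of_mem_FP`),
`CleanRevBlockDesc.lean` (the reversed clean block printed in `FP`) and `CleanXorDesc.lean` (the suffix and XOR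
layers on codes) into ONE context-generic theorem:

* `RevClean.cleanRevWordA_codeFP_id`, `…_map_codeFP` — the reversed clean word `progA (cleanOps e M u []).reverse`
  on codes (relabelled copy included);
* `CleanPlaced.relabel_codeFP_of` — the wire relabelling `relabel n₀ dpos base` on codes;
* `CleanXor.blockWord_eq` — the word of a clean XOR block split into seven printable pieces
  (`notsV`, clean block, `notsV` | XOR layer | the three reversed), the outer ones relabelled;
* `CleanXor.placedWordA_codeFP_of`, `CleanXor.placedRevWordA_codeFP_of` — the placed clean block's word and the
  reversed placed program's word on codes (two thirds of the block; reused by the Grover–Rudolph levels);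
* **`CleanXor.blockWordA_codeFP_of`** — from a context computing `n₀` (binary), `v` (string), `n₀ + |v|` (unary),
  `base` (binary), `m` (unary) and the maps `dpos`, `tpos`, the abstract gate list of the clean XOR block
  (the right-hand side of `CleanXor.map_toAG_circuit`) is computed on codes in polynomial time.

This is the generic half of the uniformity of the Regev sampler's classical stages (`circY`, `circS`, `circX` are
`CleanXor.circuit`s); what remains per block is to compute its seven parameters from the stage index. Everything is
proved; no named fact is introduced.

## References

* C. H. Bennett, *Logical reversibility of computation*, IBM J. Res. Dev. 17 (1973), §2 [Bennett1973].
* S. Arora, B. Barak, *Computational Complexity: A Modern Approach*, CUP 2009, §6.2 Def. 6.12 / Remark 6.7 and proof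
  of Thm. 6.15 [AroraBarak2009].
* M. A. Nielsen, I. L. Chuang, *Quantum Computation and Quantum Information*, CUP 2010, §3.2.5, §4.3 [NielsenChuang2010].
-/

noncomputable section

namespace Literature.Computability.QuantumComplexity

open _root_.Computability Complexity Complexity.CodeFP Cryptography Turing RevSim RevClean RevDesc AJLCore ClassicalWrap
  CleanPlaced

/-! ### The reversed clean word on codes -/

/-- **The reversed clean word on codes** from the unary tableau length. [cite: AroraBarak2009, §6.2 Remark 6.7] -/
theorem RevClean.cleanRevWordA_codeFP_id {e : ℕ} {M : TM2ComputableAux Bool Bool} :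
    CodeFP unE (rawE agE0) (fun u => progA (cleanOps e M u []).reverse) :=
  codeFP_progA_of_mem_FP (flatMap_opBits_cleanOps_reverse_mem_FP_id (e := e) (M := M)) fun _ => rfl

/-- The relabelled reversed clean word on codes. [folklore] -/
theorem RevClean.cleanRevWordA_map_codeFP {e : ℕ} {M : TM2ComputableAux Bool Bool} {σ : Type} {eσ : σ → List Bool}
    {N : σ → ℕ} {f : σ → ℕ → ℕ} (hN : CodeFP eσ unE N) (hf : CodeFP (pairE eσ natE) natE (fun q => f q.1 q.2)) :
    CodeFP eσ (rawE agE0) (fun c => (progA (cleanOps e M (N c) []).reverse).map (AGmap (f c))) :=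
  ((mapAGmap_codeFP hf).comp ((CodeFP.id _).pair ((cleanRevWordA_codeFP_id (e := e) (M := M)).comp hN))).congr
    fun _ => rfl

/-! ### The relabelling on codes -/

/-- **`relabel n₀ dpos base` on codes** (data wires through `dpos`, the rest shifted behind `base`). [folklore] -/
theorem CleanPlaced.relabel_codeFP_of {σ : Type} {eσ : σ → List Bool} {n₀ base : σ → ℕ} {dpos : σ → ℕ → ℕ}
    (hn₀ : CodeFP eσ natE n₀) (hbase : CodeFP eσ natE base) (hdpos : CodeFP (pairE eσ natE) natE (fun q => dpos q.1 q.2)) :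
    CodeFP (pairE eσ natE) natE (fun q => relabel (n₀ q.1) (dpos q.1) (base q.1) q.2) :=
  (iteProp (P := fun q : σ × ℕ => q.2 < n₀ q.1) (natLt.comp ((snd _ _).pair (hn₀.comp (fst _ _))) :) hdpos
    (natAdd.comp ((hbase.comp (fst _ _)).pair (natSub.comp ((snd _ _).pair (hn₀.comp (fst _ _))))) :) :)

/-! ### The block word -/

namespace CleanXor

variable (e : ℕ) (M : TM2ComputableAux Bool Bool)

/-- **The word of a clean XOR block in seven printable pieces.** [cite: Bennett1973, §2] [cite: NielsenChuang2010, §3.2.5] -/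
theorem blockWord_eq (n₀ : ℕ) (v : List Bool) (ρ : ℕ → ℕ) (X : List (ClOp ℕ)) :
    progA ((cleanOps e M n₀ v).map (ClOp.map ρ) ++ (X ++ ((cleanOps e M n₀ v).map (ClOp.map ρ)).reverse)) =
      (progA (notsV n₀ v) ++ (progA (cleanOps e M (n₀ + v.length) []) ++ progA (notsV n₀ v))).map (AGmap ρ) ++
        (progA X ++ (progA (notsV n₀ v).reverse ++ (progA (cleanOps e M (n₀ + v.length) []).reverse ++
          progA (notsV n₀ v).reverse)).map (AGmap ρ)) := by
  rw [progA_append, progA_append, ← List.map_reverse, progA_map, progA_map, cleanOps_eq_notsV_append]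
  simp only [List.reverse_append, progA_append, List.append_assoc]

variable {e M}

/-- **The placed clean block's word on codes**: `progA ((cleanOps e M n₀ v).map (ClOp.map (relabel n₀ dpos base)))` from
a context computing `n₀` (binary), `v` (string), `n₀ + |v|` (unary), `base` (binary) and `dpos`. (Also the first third
of a clean XOR block, and the uncompute half of a Grover–Rudolph level.)
[cite: AroraBarak2009, §6.2 Def. 6.12 / Remark 6.7 and proof of Thm. 6.15] -/
theorem placedWordA_codeFP_of {σ : Type} {eσ : σ → List Bool} {n₀ base : σ → ℕ} {v : σ → List Bool} {dpos : σ → ℕ → ℕ}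
    (hn₀ : CodeFP eσ natE n₀) (hv : CodeFP eσ strE v) (hN : CodeFP eσ unE (fun c => n₀ c + (v c).length))
    (hbase : CodeFP eσ natE base) (hdpos : CodeFP (pairE eσ natE) natE (fun q => dpos q.1 q.2)) :
    CodeFP eσ (rawE agE0) (fun c => progA ((cleanOps e M (n₀ c) (v c)).map (ClOp.map (relabel (n₀ c) (dpos c) (base c))))) := by
  have hρ := relabel_codeFP_of hn₀ hbase hdpos
  have W1 : CodeFP eσ (rawE agE0) (fun c => progA (notsV (n₀ c) (v c))) := notsA_codeFP_of hn₀ hv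
  have W2 : CodeFP eσ (rawE agE0) (fun c => progA (cleanOps e M (n₀ c + (v c).length) [])) :=
    ((cleanWordA_codeFP_id (e := e) (M := M)).comp hN :)
  exact ((mapAGmap_codeFP (f := fun c i => relabel (n₀ c) (dpos c) (base c) i) hρ).comp
      ((CodeFP.id _).pair (agAppend W1 (agAppend W2 W1)))).congr fun c => by
    show (progA (notsV (n₀ c) (v c)) ++ (progA (cleanOps e M (n₀ c + (v c).length) []) ++ progA (notsV (n₀ c) (v c)))).map
        (AGmap (relabel (n₀ c) (dpos c) (base c))) = _
    rw [progA_map, cleanOps_eq_notsV_append e M (n₀ c) (v c), progA_append, progA_append]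

/-- **The reversed placed program's word on codes**: `progA (((cleanOps e M n₀ v).map (ClOp.map (relabel …))).reverse)`
(the last third of a clean XOR block, and the compute half of a Grover–Rudolph level).
[cite: AroraBarak2009, §6.2 Def. 6.12 / Remark 6.7 and proof of Thm. 6.15] -/
theorem placedRevWordA_codeFP_of {σ : Type} {eσ : σ → List Bool} {n₀ base : σ → ℕ} {v : σ → List Bool} {dpos : σ → ℕ → ℕ}
    (hn₀ : CodeFP eσ natE n₀) (hv : CodeFP eσ strE v) (hN : CodeFP eσ unE (fun c => n₀ c + (v c).length))
    (hbase : CodeFP eσ natE base) (hdpos : CodeFP (pairE eσ natE) natE (fun q => dpos q.1 q.2)) :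
    CodeFP eσ (rawE agE0) (fun c => progA ((cleanOps e M (n₀ c) (v c)).map (ClOp.map (relabel (n₀ c) (dpos c) (base c)))).reverse) := by
  have hρ := relabel_codeFP_of hn₀ hbase hdpos
  have W3 : CodeFP eσ (rawE agE0) (fun c => progA (notsV (n₀ c) (v c)).reverse) :=
    (progA_fp.comp ((AJLCore.rawReverse clopE).comp (notsV_codeFP_of hn₀ hv)) :)
  have W4 : CodeFP eσ (rawE agE0) (fun c => progA (cleanOps e M (n₀ c + (v c).length) []).reverse) :=
    ((cleanRevWordA_codeFP_id (e := e) (M := M)).comp hN :)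
  exact ((mapAGmap_codeFP (f := fun c i => relabel (n₀ c) (dpos c) (base c) i) hρ).comp
      ((CodeFP.id _).pair (agAppend W3 (agAppend W4 W3)))).congr fun c => by
    show (progA (notsV (n₀ c) (v c)).reverse ++ (progA (cleanOps e M (n₀ c + (v c).length) []).reverse ++
        progA (notsV (n₀ c) (v c)).reverse)).map (AGmap (relabel (n₀ c) (dpos c) (base c))) = _
    rw [← List.map_reverse, progA_map, cleanOps_eq_notsV_append e M (n₀ c) (v c)]
    simp only [List.reverse_append, progA_append, List.append_assoc]

/-- **The abstract gate list of a clean XOR block on codes** (the right-hand side of `CleanXor.map_toAG_circuit`),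
from a context computing `n₀` (binary), the suffix `v` (string), `n₀ + |v|` (unary), `base` (binary), `m` (unary)
and the maps `dpos`, `tpos`. [cite: AroraBarak2009, §6.2 Def. 6.12 / Remark 6.7 and proof of Thm. 6.15]
[cite: NielsenChuang2010, §4.3] -/
theorem blockWordA_codeFP_of {σ : Type} {eσ : σ → List Bool} {n₀ base m : σ → ℕ} {v : σ → List Bool}
    {dpos tpos : σ → ℕ → ℕ} (hn₀ : CodeFP eσ natE n₀) (hv : CodeFP eσ strE v)
    (hN : CodeFP eσ unE (fun c => n₀ c + (v c).length)) (hbase : CodeFP eσ natE base) (hm : CodeFP eσ unE m)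
    (hdpos : CodeFP (pairE eσ natE) natE (fun q => dpos q.1 q.2))
    (htpos : CodeFP (pairE eσ natE) natE (fun q => tpos q.1 q.2)) :
    CodeFP eσ (rawE agE0) (fun c =>
      progA ((cleanOps e M (n₀ c) (v c)).map (ClOp.map (relabel (n₀ c) (dpos c) (base c))) ++
        (xorOpsN e M (n₀ c) (v c) (base c) (m c) (tpos c) ++
          ((cleanOps e M (n₀ c) (v c)).map (ClOp.map (relabel (n₀ c) (dpos c) (base c)))).reverse))) := by
  have hρ := relabel_codeFP_of hn₀ hbase hdpos
  have hmap : ∀ {L : σ → List AG}, CodeFP eσ (rawE agE0) L →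
      CodeFP eσ (rawE agE0) (fun c => (L c).map (AGmap (relabel (n₀ c) (dpos c) (base c)))) :=
    fun hL => ((mapAGmap_codeFP (f := fun c i => relabel (n₀ c) (dpos c) (base c) i) hρ).comp
      ((CodeFP.id _).pair hL)).congr fun _ => rfl
  have W1 : CodeFP eσ (rawE agE0) (fun c => progA (notsV (n₀ c) (v c))) := notsA_codeFP_of hn₀ hv
  have W2 : CodeFP eσ (rawE agE0) (fun c => progA (cleanOps e M (n₀ c + (v c).length) [])) :=
    ((cleanWordA_codeFP_id (e := e) (M := M)).comp hN :)
  have W3 : CodeFP eσ (rawE agE0) (fun c => progA (notsV (n₀ c) (v c)).reverse) :=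
    (progA_fp.comp ((AJLCore.rawReverse clopE).comp (notsV_codeFP_of hn₀ hv)) :)
  have W4 : CodeFP eσ (rawE agE0) (fun c => progA (cleanOps e M (n₀ c + (v c).length) []).reverse) :=
    ((cleanRevWordA_codeFP_id (e := e) (M := M)).comp hN :)
  have WX : CodeFP eσ (rawE agE0) (fun c => progA (xorOpsN e M (n₀ c) (v c) (base c) (m c) (tpos c))) :=
    xorA_codeFP_of hn₀ hN hbase hm htpos
  have hP := hmap (agAppend W1 (agAppend W2 W1))
  have hR := hmap (agAppend W3 (agAppend W4 W3))
  exact (agAppend hP (agAppend WX hR)).congr fun c => by rw [blockWord_eq]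

end CleanXor

end Literature.Computability.QuantumComplexity

end
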